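import Summits.BirchSwinnertonDyer.BirchSwinnertonDyer.Theorems.ByReductionTypeAtTwoMultKatoRatOfInputs
import Summits.BirchSwinnertonDyer.BirchSwinnertonDyer.Theorems.ByReductionTypeAtTwoMultKatoInputsDefs
import Summits.BirchSwinnertonDyer.BirchSwinnertonDyer.Theorems.ByReductionTypeAtTwoMultUpperHalfDefs
import HarnessLib

/-!
# K11 in the KERNEL modulo located inputs, part 2: `X5.O1.KatoMultiplicativeDivisibilityRat W 2` (K11a /
# K11b-Rat) from `nonempty_iwasawaH1Data`, `thm12_4`, Greenberg's Thm. 1.5 and the two Summits-side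
# `p = 2` package constants `MultKatoInputs.exists_multDivisibilityInputs_{nonsplit,split}_two`

Cell `bsd-2adic` (run/shared/lean/pub/bsd-2adic/), seat `bsd-2adic-mult` GEN 9; HUMAN RULINGS D-0036 /
D-0054; director (Q2) 2026-08-26 «make it a KERNEL theorem». HONEST FRAMING: research route; nothing is
asserted; no class is closed here; no count moves. PARTITION: X5@2 multiplicative (K4ᵐ, RESIDUAL-MAP
B1·O1; 1 976 book230 classes) × p = 2 — types-the-object-of; bears_on K4 items 19922 / 19923.

Part 1 (`ByReductionTypeAtTwoMultKatoRatOfInputs.lean`) proves the assembly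
`katoMultiplicativeDivisibilityRat_of_packages` (any `p`) and K11 at odd `p` from Literature facts.
Here the package providers at `p = 2` are the two `@[conjecture]` constants of
`ByReductionTypeAtTwoMultKatoInputsDefs.lean` (the `p := 2` siblings of the odd-prime Literature facts
`Kato2004.exists_multDivisibilityInputs_{nonsplit,split}`; Literature review ruling: the `p = 2`
extension is a Summits obligation; ONE unprinted field each — Coleman-map injectivity at a non-split
`2` [reading `Kato17.11@2-nonsplit`], injectivity + `I`-valuedness at a split `2` [Kobayashi 4.1 @2 =
cell memo PROOF-KATO2SPLIT]). OUTPUT: `katoMultiplicativeDivisibilityRat_two_of_inputs` (the cell's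
prime-uniform binder at `2`), `katoRatAtMultTwo_of_inputs` (= the registered stub constant
`MultUpperHalvesAtTwo.KatoRatAtMultTwo` of crux 19922's line `four_roads`, modulo the five inputs),
`…_forall_two_of_inputs` (verbatim the `hKato` binder
`∀ W, ¬ W.HasCM → Mult W 2 → O1.KatoMultiplicativeDivisibilityRat W 2` of the 677 MultTowerClass /
SelmerRank / transport files), and the projections `katoDivisibilityAtTwo{Nonsplit,Split}MultRat_of_inputs`
(K11a / K11b-Rat for every newform `f` and every `L`). Before: K11 at `2` = Summits `@[conjecture]` of
GLOBAL shape + three memos; after: kernel ∘ {2 accepted Kato facts, h15 PRINT, 2 typed LOCAL packages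
with one named unprinted field each}. WHAT THIS IS NOT: not a proof of Prop. 17.11 / Kobayashi 4.1 at
`2`; not the integral clause; no class closes; nothing is booked.

References: [Kato2004Asterisque] §17.13 (pp. 279–280), Thm. 12.5 (3) (p. 222), Prop. 17.11 / Lemma 17.12
(pp. 277–278); [Wuthrich2014] p. 391, Cor. 19; [Kobayashi2006DocMath] Thm. 4.1; [GreenbergLNM1716]
Thm. 1.5, §2; cell memos HOME/mult/KERNEL-K11-INPUTS.md, K11-RESIDUE-CARD.md.
-/

set_option autoImplicit false
-- the Theorems namespace of this sub repeats the summit name by design (D-0017 nested layout: Summit.<S>.<Sub>)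
set_option linter.dupNamespace false

noncomputable section

open scoped Classical MatrixGroups ModularForm

open CongruenceSubgroup WeierstrassCurve Literature.NumberTheory.EllipticCurves
  Literature.NumberTheory.EllipticCurves.ModularForms
  Literature.NumberTheory.EllipticCurves.Rank1Residual
  Literature.NumberTheory.EllipticCurves.Greenberg1999
  Summit.BirchSwinnertonDyer.Rank1Residual
  Summit.BirchSwinnertonDyer.BirchSwinnertonDyer.Theorems.MultKatoInputs

namespace Summit.BirchSwinnertonDyer.BirchSwinnertonDyer.Theorems.MultKatoRat

variable (W : WeierstrassCurve ℚ) [W.IsElliptic] [W.IsGloballyMinimal]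

/-- **K11 at `p = 2` — kernel modulo the two typed `p = 2` input packages.** The accepted Kato facts
`nonempty_iwasawaH1Data`, `thm12_4`, Greenberg's Thm. 1.5, and the Summits-side `p = 2` constants
`exists_multDivisibilityInputs_nonsplit_two` / `exists_multDivisibilityInputs_split_two`
(`ByReductionTypeAtTwoMultKatoInputsDefs.lean`: the §17.13 packages at a multiplicative `2`, one
unprinted field each) imply `X5.O1.KatoMultiplicativeDivisibilityRat W 2`.
[cite: Kato2004Asterisque, Thm. 17.4 (1)(2) (p. 273; shape), Thm. 12.5 (3) (p. 222), §17.13 (pp. 279–280)] -/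
theorem katoMultiplicativeDivisibilityRat_two_of_inputs (hne : Kato2004.nonempty_iwasawaH1Data)
    (h12 : Kato2004.thm12_4) (hns : exists_multDivisibilityInputs_nonsplit_two)
    (hsp : exists_multDivisibilityInputs_split_two) (h15 : thm15_isTorsion_multiplicative_rat) :
    X5.O1.KatoMultiplicativeDivisibilityRat W 2 :=
  katoMultiplicativeDivisibilityRat_of_packages W 2 hne h12 h15
    (fun f κ γ hm hn hκ hγ hγ' hf L hL I D => hns W f κ γ hm hn hκ hγ hγ' hf L hL I D)
    (fun f κ γ hs hκ hγ hγ' hf L hL I D => hsp W f κ γ hs hκ hγ hγ' hf L hL I D)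

/-- **The universal `hKato` binder of the mult lane's class files at `2`, from the inputs.** The
`MultTowerClass<cls>` / `MultSelmerRank` / transport files display
`hKato : ∀ W, ¬ W.HasCM → Mult W 2 → O1.KatoMultiplicativeDivisibilityRat W 2`; this is that binder
(the `¬ CM` guard is not used) — feed
`(katoMultiplicativeDivisibilityRat_forall_two_of_inputs hne h12 hns hsp h15)` where `hKato` is asked.
[cite: Kato2004Asterisque, Thm. 17.4 (1)(2) (p. 273; shape) and §17.13 (pp. 279–280)] -/
theorem katoMultiplicativeDivisibilityRat_forall_two_of_inputs (hne : Kato2004.nonempty_iwasawaH1Data)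
    (h12 : Kato2004.thm12_4) (hns : exists_multDivisibilityInputs_nonsplit_two)
    (hsp : exists_multDivisibilityInputs_split_two) (h15 : thm15_isTorsion_multiplicative_rat) :
    ∀ (V : WeierstrassCurve ℚ) [V.IsElliptic] [V.IsGloballyMinimal],
      ¬ V.HasCM → Mult V 2 → X5.O1.KatoMultiplicativeDivisibilityRat V 2 :=
  fun V _ _ _ _ => katoMultiplicativeDivisibilityRat_two_of_inputs V hne h12 hns hsp h15

/-- **`stub_katoRat` of crux 19922 (line `four_roads`) modulo the inputs**: the registered stub
constant `MultUpperHalvesAtTwo.KatoRatAtMultTwo` (`∀ W, ¬ W.HasCM → Mult W 2 →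
O1.KatoMultiplicativeDivisibilityRat W 2`, file `ByReductionTypeAtTwoMultUpperHalfDefs.lean`; the `hKato`
binder of mult-2's six-road reduction and of every MultTowerClass file) follows from
`nonempty_iwasawaH1Data`, `thm12_4`, the two `p = 2` package constants and Greenberg's Thm. 1.5 —
the stub's residue is thereby the ONE unprinted field per sign of the packages (NOT a proof of the stub:
its five inputs stay displayed). [cite: Kato2004Asterisque, Thm. 17.4 (1)(2) (p. 273; shape) and §17.13 (pp. 279–280)] -/
theorem katoRatAtMultTwo_of_inputs (hne : Kato2004.nonempty_iwasawaH1Data) (h12 : Kato2004.thm12_4)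
    (hns : exists_multDivisibilityInputs_nonsplit_two) (hsp : exists_multDivisibilityInputs_split_two)
    (h15 : thm15_isTorsion_multiplicative_rat) : MultUpperHalvesAtTwo.KatoRatAtMultTwo :=
  fun V _ _ _ _ => katoMultiplicativeDivisibilityRat_two_of_inputs V hne h12 hns hsp h15

/-- **K11a at `p = 2` from the inputs**: `X5.O1.KatoDivisibilityAtTwoNonsplitMultRat W f L` for every
newform `f` and every `L`, by the tree's projection `katoDivisibilityAtTwoNonsplitMultRat_of_multRat`.
[cite: Kato2004Asterisque, Thm. 17.4 (1)(2) (p. 273; shape) and §17.13 (pp. 279–280)] -/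
theorem katoDivisibilityAtTwoNonsplitMultRat_of_inputs (hne : Kato2004.nonempty_iwasawaH1Data)
    (h12 : Kato2004.thm12_4) (hns : exists_multDivisibilityInputs_nonsplit_two)
    (hsp : exists_multDivisibilityInputs_split_two) (h15 : thm15_isTorsion_multiplicative_rat)
    {N : ℕ} [NeZero N] (f : CuspForm (Gamma0 N) 2) (L : PowerSeries ℚ_[2]) :
    X5.O1.KatoDivisibilityAtTwoNonsplitMultRat W f L :=
  X5.O1.katoDivisibilityAtTwoNonsplitMultRat_of_multRat W
    (katoMultiplicativeDivisibilityRat_two_of_inputs W hne h12 hns hsp h15) f L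

/-- **K11b-Rat at `p = 2` from the inputs**: `X5.O1.KatoDivisibilityAtTwoSplitMultRat W f L` for every
newform `f` and every `L`, by the tree's projection `katoDivisibilityAtTwoSplitMultRat_of_multRat`.
[cite: Kato2004Asterisque, Thm. 12.5 (3) (p. 222) and §17.13 (pp. 279–280)] [cite: Wuthrich2014, Cor. 19 (p. 398; shape)] -/
theorem katoDivisibilityAtTwoSplitMultRat_of_inputs (hne : Kato2004.nonempty_iwasawaH1Data)
    (h12 : Kato2004.thm12_4) (hns : exists_multDivisibilityInputs_nonsplit_two)
    (hsp : exists_multDivisibilityInputs_split_two) (h15 : thm15_isTorsion_multiplicative_rat)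
    {N : ℕ} [NeZero N] (f : CuspForm (Gamma0 N) 2) (L : PowerSeries ℚ_[2]) :
    X5.O1.KatoDivisibilityAtTwoSplitMultRat W f L :=
  X5.O1.katoDivisibilityAtTwoSplitMultRat_of_multRat W
    (katoMultiplicativeDivisibilityRat_two_of_inputs W hne h12 hns hsp h15) f L

end Summit.BirchSwinnertonDyer.BirchSwinnertonDyer.Theorems.MultKatoRat

end
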